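import Literature.AlgebraicGeometry.ShimuraVarieties.UnitaryShimuraCurveRecord
import Literature.NumberTheory.Automorphic.UnitaryGroupFrameEmbedding
import HarnessLib

/-!
# The reciprocity twist of a CM pair of the unitary Shimura CURVE is carried by `φ = R_B ∘ (· ⊕ 1)` to the
# reciprocity twist of the image CM pair of the SURFACE (twist transport along the sub-datum `U(J⋆) ↪ U(H)`)

Topic `AlgebraicGeometry/ShimuraVarieties`, namespace `…ShimuraVarieties.UnitaryCanonicalModel`. THEOREMS ONLY
(no definition, no named fact, no instance, no `sorry`).

Setting of ★ `UnitaryShimuraCurveRecord` §5 / ★ `UnitaryShimuraCurveEmbeddingPoints`: a CM field `L` (involution `c`),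
hermitian `H ∈ M₃(L)`, `J⋆ ∈ M₂(L)`, `J⊥ ∈ M₁(L)` and a frame `B ∈ GL₃(L)` with `ᵗ(cB)·(a·H)·B = J⋆ ⊕ J⊥` (`a ≠ 0`), so
that `φGS = R_B ∘ (· ⊕ 1) : U(J⋆)(𝔸_{L⁺,f}) → U(H)(𝔸_{L⁺,f})` (★ `φGS`) is the finite-adelic inclusion `G⋆ ↪ G` of the
sub-Shimura datum of [Liu2021] Thm. 4.15 and `x ↦ B·(x ⊕ 0)` is the embedding `V⋆ ↪ V` of `L`-vector spaces.

**Twist transport** (`isDiagTwist_φGS_of_isDiagTwistGS`): if `d⋆ ∈ U(J⋆)(𝔸_{L⁺,f})` is the diagonal twist of the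
CM pair of the curve at the negative `L`-line `L·w` with eigenvalue `t` (★ `IsDiagTwistGS L J⋆ w t d⋆`: `t` on `w ⊗ 1`,
identity on `w^{⊥_{J⋆}}`), then `φGS(d⋆) ∈ U(H)(𝔸_{L⁺,f})` is the diagonal twist of the image CM pair of the surface at
the `L`-line of `v₃ = B·(w ⊕ 0)` with the same eigenvalue (★ `IsDiagTwist L H v₃ t (φGS d⋆)`: `t` on `v₃ ⊗ 1`, identity on
`v₃^{⊥_H}`).  In print: for the morphism of Shimura data `(G⋆, h⋆) → (G, h)` the special pair `(T⋆, x⋆)` maps to the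
special pair `(φ(T⋆)·T', φ(x⋆))` and `r_{φ(x⋆)} = φ ∘ r_{x⋆}` ([Milne2005ShimuraVarieties] (60)–(61) p. 114 are functorial in
the datum; [Deligne1979ShimuraVarieties] 2.2.4–2.2.6, the functoriality of canonical models «en `(G, X)`») — here in the
tree's explicit rank-one-twist currency: the eigen-part is the frame intertwining ★ `conj_blockDiagFin_mulVec_frameEmb`
read over `𝔸_{L,f}`, the fixed part is the orthogonal splitting `V = B(V⋆ ⊕ 0) ⊕ B(0 ⊕ V⋆^⊥)` (★ `mul_hermForm_frameEmb_eq`)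
in `B⁻¹`-coordinates.  Consumer: the descent of the complex EMBEDDING `Sh(U(J⋆)) → Sh(U(H))` to the reflex field (the
u2 conjunct `EmbeddingDefinedOver` of ★ `exists_recordSystemGS`; file `UnitaryShimuraCurveEmbeddingDescent`), where the
TARGET record's reciprocity is applied with the transported twist.

## References
* [Milne2005ShimuraVarieties] J. S. Milne, *Introduction to Shimura varieties* (2005; held rev. 2017
  `paper:url-b0e8e4ca1c12`), Def. 12.5 p. 113, (60)–(62) p. 114, Thm. 13.7 / Rem. 13.8 p. 119, §5 (5.1) p. 56.
* [Deligne1979ShimuraVarieties] P. Deligne, *Variétés de Shimura* (1979), 2.2.4–2.2.6.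
* [Kudla1984] S. Kudla, *Seesaw dual reductive pairs* (1984), §1 (`U(V⋆) × U(V⋆^⊥) ⊂ U(V)`).
* [Liu2021] Y. Liu, Camb. J. Math. 9 (2021), proof of Thm. 4.15 (FJcycle.tex l. 2193–2208).
-/

set_option autoImplicit false

noncomputable section

open Function NumberField IsDedekindDomain Matrix
open scoped Matrix
open Literature.NumberTheory.Automorphic Literature.NumberTheory.Automorphic.UnitaryGroup

namespace Literature.AlgebraicGeometry.ShimuraVarieties.UnitaryCanonicalModel

variable (L : Type) [Field L] [NumberField L] [IsCMField L]

/-! ### §1. Bookkeeping: `L`-vectors read over `𝔸_{L,f}` through a frame -/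

omit [IsCMField L] in
/-- `(x ⊕ y) ⊗ 1 = (x ⊗ 1) ⊕ (y ⊗ 1)` (componentwise `algebraMap`). [folklore] -/
private theorem adelicVecFin_append {N₁ N₂ : ℕ} (x : Fin N₁ → L) (y : Fin N₂ → L) :
    adelicVecFin L (Fin.append x y) = Fin.append (adelicVecFin L x) (adelicVecFin L y) := by
  funext i
  refine Fin.addCases (fun j => ?_) (fun j => ?_) i
  · simp only [adelicVecFin, Fin.append_left]
  · simp only [adelicVecFin, Fin.append_right]

omit [IsCMField L] in
/-- `0 ⊗ 1 = 0`. [folklore] -/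
private theorem adelicVecFin_zero {N : ℕ} : adelicVecFin L (0 : Fin N → L) = 0 := by
  funext i; simp only [adelicVecFin, Pi.zero_apply, map_zero]

omit [IsCMField L] in
/-- The rank-3 `adelicVec` is the rank-generic `adelicVecFin` (same body). [folklore] -/
private theorem adelicVec_eq_adelicVecFin (v : Fin 3 → L) : adelicVec L v = adelicVecFin L v := rfl

omit [IsCMField L] in
/-- `(B v) ⊗ 1 = B_f · (v ⊗ 1)` for `B ∈ GL_N(L)` and its diagonal image `B_f ∈ GL_N(𝔸_{L,f})` (★ `toFinAdeleGL`).
[cite: PlatonovRapinchuk1994, §5.1] -/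
private theorem adelicVecFin_mulVec {N : ℕ} (B : GL (Fin N) L) (v : Fin N → L) :
    adelicVecFin L ((B : Matrix (Fin N) (Fin N) L) *ᵥ v) =
      ((toFinAdeleGL L N B : GL (Fin N) (FiniteAdeleRing (𝓞 L) L)) : Matrix (Fin N) (Fin N) (FiniteAdeleRing (𝓞 L) L)) *ᵥ
        adelicVecFin L v := by
  funext i
  exact RingHom.map_mulVec (algebraMap L (FiniteAdeleRing (𝓞 L) L)) (B : Matrix (Fin N) (Fin N) L) v i

/-- `t • (x ⊕ 0) = (t • x) ⊕ 0`. [folklore] -/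
private theorem smul_append_zero {R : Type*} [CommRing R] {N₁ N₂ : ℕ} (t : R) (x : Fin N₁ → R) :
    t • Fin.append x (0 : Fin N₂ → R) = Fin.append (t • x) (0 : Fin N₂ → R) := by
  funext i
  refine Fin.addCases (fun j => ?_) (fun j => ?_) i
  · simp only [Pi.smul_apply, Fin.append_left]
  · simp only [Pi.smul_apply, Fin.append_right, Pi.zero_apply, smul_zero]

omit [NumberField L] [IsCMField L] in
/-- A vector of `L^{N₁+N₂}` in `B`-coordinates splits as `B·(y⋆ ⊕ y⊥)` with `y = B⁻¹ v`. [folklore] -/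
private theorem eq_frame_mulVec_append {N₁ N₂ : ℕ} (B : GL (Fin (N₁ + N₂)) L) (v : Fin (N₁ + N₂) → L) :
    v = (B : Matrix (Fin (N₁ + N₂)) (Fin (N₁ + N₂)) L) *ᵥ
      Fin.append (fun i => (((B⁻¹ : GL (Fin (N₁ + N₂)) L) : Matrix (Fin (N₁ + N₂)) (Fin (N₁ + N₂)) L) *ᵥ v) (Fin.castAdd N₂ i))
        (fun j => (((B⁻¹ : GL (Fin (N₁ + N₂)) L) : Matrix (Fin (N₁ + N₂)) (Fin (N₁ + N₂)) L) *ᵥ v) (Fin.natAdd N₁ j)) := by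
  have happ : Fin.append
      (fun i => (((B⁻¹ : GL (Fin (N₁ + N₂)) L) : Matrix (Fin (N₁ + N₂)) (Fin (N₁ + N₂)) L) *ᵥ v) (Fin.castAdd N₂ i))
      (fun j => (((B⁻¹ : GL (Fin (N₁ + N₂)) L) : Matrix (Fin (N₁ + N₂)) (Fin (N₁ + N₂)) L) *ᵥ v) (Fin.natAdd N₁ j)) =
      ((B⁻¹ : GL (Fin (N₁ + N₂)) L) : Matrix (Fin (N₁ + N₂)) (Fin (N₁ + N₂)) L) *ᵥ v := by
    funext i
    refine Fin.addCases (fun j => ?_) (fun j => ?_) i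
    · simp only [Fin.append_left]
    · simp only [Fin.append_right]
  rw [happ, mulVec_mulVec, ← Units.val_mul, mul_inv_cancel, Units.val_one, one_mulVec]

/-! ### §2. Twist transport along `φGS = R_B ∘ (· ⊕ 1)` -/

section Transport

variable (Jstar : Matrix (Fin 2) (Fin 2) L) (Jperp : Matrix (Fin 1) (Fin 1) L) (H : Matrix (Fin 3) (Fin 3) L)
  (B : GL (Fin 3) L) {a : L} (ha : a ≠ 0)
  (hB : formCongr ((IsCMField.complexConj L : L ≃ₐ[↥(maximalRealSubfield L)] L) : L →+* L) B (a • H) =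
    finSum 2 1 Jstar Jperp)

/-- **`φGS(u)` acts on the frame embedding blockwise**: `φGS(u)_f · B_f((x ⊗ 1) ⊕ (y ⊗ 1)) = B_f((u·x) ⊕ y)` over
`𝔸_{L,f}` (★ `conj_blockDiagFin_mulVec_frameEmb` for the block-diagonal `u ⊕ 1` in the frame `B_f`; the matrix of
`φGS(u) = R_B(u ⊕ 1)` is `B_f (u ⊕ 1) B_f⁻¹` by ★ `coe_finAdelicCongr_apply`). [cite: Kudla1984, §1]
[cite: Liu2021, Thm. 4.15 proof (FJcycle.tex l. 2193–2203)] -/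
theorem coe_φGS_mulVec_frame_append (u : ↥(finAdelic (↥(maximalRealSubfield L)) L (IsCMField.complexConj L) 2 Jstar))
    (x : Fin 2 → FiniteAdeleRing (𝓞 L) L) (y : Fin 1 → FiniteAdeleRing (𝓞 L) L) :
    (((φGS L Jstar Jperp H B ha hB u : ↥(finAdelic (↥(maximalRealSubfield L)) L (IsCMField.complexConj L) 3 H)) :
        GL (Fin 3) (FiniteAdeleRing (𝓞 L) L)) : Matrix (Fin 3) (Fin 3) (FiniteAdeleRing (𝓞 L) L)) *ᵥ
        (((toFinAdeleGL L 3 B : GL (Fin 3) (FiniteAdeleRing (𝓞 L) L)) :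
          Matrix (Fin 3) (Fin 3) (FiniteAdeleRing (𝓞 L) L)) *ᵥ Fin.append x y) =
      ((toFinAdeleGL L 3 B : GL (Fin 3) (FiniteAdeleRing (𝓞 L) L)) : Matrix (Fin 3) (Fin 3) (FiniteAdeleRing (𝓞 L) L)) *ᵥ
        Fin.append ((((u : ↥(finAdelic (↥(maximalRealSubfield L)) L (IsCMField.complexConj L) 2 Jstar)) :
          GL (Fin 2) (FiniteAdeleRing (𝓞 L) L)) : Matrix (Fin 2) (Fin 2) (FiniteAdeleRing (𝓞 L) L)) *ᵥ x) y := by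
  have key := conj_blockDiagFin_mulVec_frameEmb (N₁ := 2) (N₂ := 1)
    (conjFiniteAdele (↥(maximalRealSubfield L)) L (IsCMField.complexConj L))
    (finiteAdelicForm L 2 Jstar) (finiteAdelicForm L 1 Jperp)
    (toFinAdeleGL L 3 B) (u, 1) x y
  rw [OneMemClass.coe_one, Units.val_one, one_mulVec] at key
  exact key

variable {w : Fin 2 → L} {t : FiniteAdeleRing (𝓞 L) L}
  {dstar : ↥(finAdelic (↥(maximalRealSubfield L)) L (IsCMField.complexConj L) 2 Jstar)}

/-- **Eigen-part transport**: if `d⋆ · (w ⊗ 1) = t · (w ⊗ 1)` then `φGS(d⋆) · (B(w ⊕ 0) ⊗ 1) = t · (B(w ⊕ 0) ⊗ 1)`.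
[cite: Milne2005ShimuraVarieties, (60)–(61) p. 114] [cite: Kudla1984, §1] -/
theorem φGS_mulVec_adelicVec_frameEmb_of_mulVec_eq_smul
    (hd : ((dstar : GL (Fin 2) (FiniteAdeleRing (𝓞 L) L)) : Matrix (Fin 2) (Fin 2) (FiniteAdeleRing (𝓞 L) L)) *ᵥ
      adelicVecFin L w = t • adelicVecFin L w) :
    (((φGS L Jstar Jperp H B ha hB dstar : ↥(finAdelic (↥(maximalRealSubfield L)) L (IsCMField.complexConj L) 3 H)) :
        GL (Fin 3) (FiniteAdeleRing (𝓞 L) L)) : Matrix (Fin 3) (Fin 3) (FiniteAdeleRing (𝓞 L) L)) *ᵥ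
        adelicVec L ((B : Matrix (Fin 3) (Fin 3) L) *ᵥ Fin.append w (0 : Fin 1 → L)) =
      t • adelicVec L ((B : Matrix (Fin 3) (Fin 3) L) *ᵥ Fin.append w (0 : Fin 1 → L)) := by
  rw [adelicVec_eq_adelicVecFin, adelicVecFin_mulVec, adelicVecFin_append, adelicVecFin_zero,
    coe_φGS_mulVec_frame_append, hd, ← mulVec_smul, smul_append_zero]

/-- **Fixed-part transport**: if `d⋆` fixes `w^{⊥_{J⋆}} ⊗ 1` pointwise then `φGS(d⋆)` fixes `(B(w ⊕ 0))^{⊥_H} ⊗ 1`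
pointwise — a vector `w₃ ⊥_H B(w ⊕ 0)` is `B(y⋆ ⊕ y⊥)` with `y⋆ ⊥_{J⋆} w` (the frame is an isometry up to `a`, ★
`mul_hermForm_frameEmb_eq`), and `R_B(d⋆ ⊕ 1)` acts on it as `B(d⋆ y⋆ ⊕ y⊥) = B(y⋆ ⊕ y⊥)`.
[cite: Milne2005ShimuraVarieties, (60)–(61) p. 114] [cite: Kudla1984, §1] -/
theorem φGS_mulVec_adelicVec_of_hermForm_eq_zero
    (hd : ∀ w' : Fin 2 → L, hermForm (cmConjRingHom L) Jstar w' w = 0 →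
      ((dstar : GL (Fin 2) (FiniteAdeleRing (𝓞 L) L)) : Matrix (Fin 2) (Fin 2) (FiniteAdeleRing (𝓞 L) L)) *ᵥ
        adelicVecFin L w' = adelicVecFin L w')
    {w₃ : Fin 3 → L}
    (hw₃ : hermForm (cmConjRingHom L) H w₃ ((B : Matrix (Fin 3) (Fin 3) L) *ᵥ Fin.append w (0 : Fin 1 → L)) = 0) :
    (((φGS L Jstar Jperp H B ha hB dstar : ↥(finAdelic (↥(maximalRealSubfield L)) L (IsCMField.complexConj L) 3 H)) :
        GL (Fin 3) (FiniteAdeleRing (𝓞 L) L)) : Matrix (Fin 3) (Fin 3) (FiniteAdeleRing (𝓞 L) L)) *ᵥ adelicVec L w₃ =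
      adelicVec L w₃ := by
  -- `B⁻¹`-coordinates of `w₃`
  set ys : Fin 2 → L :=
    fun i => (((B⁻¹ : GL (Fin 3) L) : Matrix (Fin 3) (Fin 3) L) *ᵥ w₃) (Fin.castAdd 1 i) with hys
  set yp : Fin 1 → L :=
    fun j => (((B⁻¹ : GL (Fin 3) L) : Matrix (Fin 3) (Fin 3) L) *ᵥ w₃) (Fin.natAdd 2 j) with hyp
  have hw : w₃ = (B : Matrix (Fin 3) (Fin 3) L) *ᵥ Fin.append ys yp :=
    eq_frame_mulVec_append L (N₁ := 2) (N₂ := 1) B w₃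
  -- `y⋆ ⊥_{J⋆} w` (the frame is an isometry up to the non-zero scalar `a`)
  have hiso : a * hermForm (cmConjRingHom L) H ((B : Matrix (Fin 3) (Fin 3) L) *ᵥ Fin.append ys yp)
      ((B : Matrix (Fin 3) (Fin 3) L) *ᵥ Fin.append w (0 : Fin 1 → L)) =
      hermForm (cmConjRingHom L) Jstar ys w + hermForm (cmConjRingHom L) Jperp yp (0 : Fin 1 → L) :=
    mul_hermForm_frameEmb_eq (N₁ := 2) (N₂ := 1)
      ((IsCMField.complexConj L : L ≃ₐ[↥(maximalRealSubfield L)] L) : L →+* L) (B := B) hB ys w yp (0 : Fin 1 → L)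
  have hperp : hermForm (cmConjRingHom L) Jstar ys w = 0 := by
    have h0 : hermForm (cmConjRingHom L) Jperp yp (0 : Fin 1 → L) = 0 := by
      simp only [hermForm, mulVec_zero, dotProduct_zero]
    rw [← hw, hw₃, mul_zero, h0, add_zero] at hiso
    exact hiso.symm
  -- `R_B(d⋆ ⊕ 1)` acts blockwise and `d⋆` fixes `y⋆ ⊗ 1`
  rw [hw, adelicVec_eq_adelicVecFin, adelicVecFin_mulVec, adelicVecFin_append, coe_φGS_mulVec_frame_append,
    hd ys hperp]

/-- **TWIST TRANSPORT along `φGS = R_B ∘ (· ⊕ 1)`**: the diagonal twist `d⋆ = r_{x⋆}(s)` of the CM pair of the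
CURVE at the negative `L`-line `L·w` (★ `IsDiagTwistGS`: eigenvalue `t` on `w`, identity on `w^{⊥_{J⋆}}`) is carried to
the diagonal twist of the image CM pair of the SURFACE at the `L`-line of `v₃ = B·(w ⊕ 0)` (★ `IsDiagTwist`: eigenvalue
`t` on `v₃`, identity on `v₃^{⊥_H}`) — `r_{φ(x⋆)} = φ ∘ r_{x⋆}` for the morphism of Shimura data `(U(J⋆), 𝔻) → (U(H), 𝔹²)`
([Milne2005ShimuraVarieties] (60)–(61): `r_x` is functorial in the datum; [Deligne1979ShimuraVarieties] 2.2.4–2.2.6).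
[cite: Milne2005ShimuraVarieties, (60)–(62) p. 114 and Rem. 13.8 p. 119] [cite: Deligne1979ShimuraVarieties, 2.2.4–2.2.6] -/
theorem isDiagTwist_φGS_of_isDiagTwistGS (hd : IsDiagTwistGS L Jstar w t dstar) :
    IsDiagTwist L H ((B : Matrix (Fin 3) (Fin 3) L) *ᵥ Fin.append w (0 : Fin 1 → L)) t
      (φGS L Jstar Jperp H B ha hB dstar) :=
  ⟨φGS_mulVec_adelicVec_frameEmb_of_mulVec_eq_smul L Jstar Jperp H B ha hB hd.1,
    fun _ hw₃ => φGS_mulVec_adelicVec_of_hermForm_eq_zero L Jstar Jperp H B ha hB hd.2 hw₃⟩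

/-- **The reciprocity twist of the image CM pair exists AS AN IMAGE**: for every finite idèle `s` there is
`d⋆ ∈ U(J⋆)(𝔸_{L⁺,f})` with `IsDiagTwistGS L J⋆ w (recipFactor L s) d⋆` whose image `φGS(d⋆)` satisfies
`IsDiagTwist L H (B(w ⊕ 0)) (recipFactor L s) (φGS d⋆)` (★ `UnitaryGroupDiagonalTwistExists` + transport) — the form
in which the SOURCE and TARGET reciprocity laws are applied together in the descent of the embedding.
[cite: Milne2005ShimuraVarieties, (60)–(62) p. 114 and Rem. 13.8 p. 119] [cite: Deligne1979ShimuraVarieties, 2.2.4–2.2.6] -/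
theorem isDiagTwist_φGS (hd : IsDiagTwistGS L Jstar w t dstar) (w₃ : Fin 3 → L)
    (hw₃ : w₃ = (B : Matrix (Fin 3) (Fin 3) L) *ᵥ Fin.append w (0 : Fin 1 → L)) :
    IsDiagTwist L H w₃ t (φGS L Jstar Jperp H B ha hB dstar) := by
  subst hw₃
  exact isDiagTwist_φGS_of_isDiagTwistGS L Jstar Jperp H B ha hB hd

end Transport

end Literature.AlgebraicGeometry.ShimuraVarieties.UnitaryCanonicalModel

end
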